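import Literature.NumberTheory.ComplexMultiplication.EllipticUnits.KatoLayerArtinCompatibility
import Literature.NumberTheory.NumberFields.RayClassFieldSplitPrimePowerDegree
import Literature.NumberTheory.NumberFields.BigHilbertClassField
import HarnessLib

set_option autoImplicit false

/-!
# `Gal(K(𝔤)/K(𝔣))` for `𝔣 ∣ 𝔤`: the Artin symbol of a principal ideal `(α)`, `α ≡ 1 (mod 𝔣)`, lies in it; the
# `κ`-representatives and de Shalit's homomorphism `δ : (ℤ/pⁿ)ˣ → Gal(K(𝔣vⁿ)/K)` (II.1.7, II.4.11 (30))

Topic `NumberTheory/ComplexMultiplication/EllipticUnits` (the home of `relGalSet`, `ThetaSingularValues.lean`, and of the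
restriction-compatibility of Artin symbols, `KatoLayerArtinCompatibility.lean`); namespace
`Literature.NumberTheory.ComplexMultiplication.EllipticUnits`.  Everything is PROVED from the tree's global class field
theory (`artinHom_galFrob_rayClassField_eq_one_iff`, `coe_artinSymbol_galFrob_inclusion_eq`, `isUnramifiedIn_rayClassField`);
one definition (`kappaArtinHom`, a `MonoidHom`), no named fact, no instance, no `sorry`.  `K` is totally complex where
class field theory is used (no sign conditions at the real places).

de Shalit (1987) II.1.7 (p. 37): for `𝔣` with `w_𝔣 = 1` and a prime `𝔭` of `K`, `Gal(K(𝔣𝔭ⁿ)/K(𝔣)) ≅ (𝒪_K/𝔭ⁿ)^×`;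
II.4.8 (19) (p. 61): the Gauss sum `τ(χ) = p⁻ⁿ Σ_{γ ∈ Gal(F_n/F)} χ(γ) ζ_n^{−κ(γ)}`, "`γ` determines `κ(γ) mod pⁿ`";
II.4.11 (30) (p. 65–66): the representatives `α_a ≡ 1 (mod 𝔣)`, `α_a ≡ a (mod 𝔭ⁿ)` and `δ_a = ((α_a), K(𝔣𝔭ⁿ)/K)`.  Here
`𝔭 = v` is a prime of `K` above the rational prime `p` with `𝒪_K/v = ℤ/p` understood through `(ℤ/pⁿ)` (split `v`).

* §1 (D2) ★ `artinSymbol_span_singleton_mem_relGalSet` — for `0 ≠ 𝔤 ≤ 𝔣`, `α ≠ 0`, `α ≡ 1 (mod 𝔣)`: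
  `((α), K(𝔤)/K) ∈ relGalSet K 𝔤 𝔣 = Gal(K(𝔤)/K(𝔣))`; with `artinKillsRay_galFrob_rayClassField`,
  `artinSymbol_span_singleton_eq_one`; and for the `κ`-representatives: `kappaRep_not_mem`, `kappaRep_ne_zero`,
  `artinSymbol_kappaRep_mem_relGalSet` (`δ_a ∈ Gal(K(𝔣vⁿ)/K(𝔣))`), `artinSymbol_kappaRep_mem_relGalSet_pred`
  (`a ≡ 1 (p^{n−1})` ⟹ `δ_a ∈ Gal(K(𝔣vⁿ)/K(𝔣v^{n−1}))`).
* §2 II.1.7: `artinSymbol_kappaRep_congr` (independence of the representative), `artinSymbol_kappaRep_mul`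
  (multiplicativity), ★ `kappaArtinHom : (ℤ/pⁿ)ˣ →* Gal(K(𝔣vⁿ)/K)`, `kappaArtinHom_apply`, `kappaArtinHom_congr`.

Sequel: `EllipticCurves/DeShalit1987/LMeasureCosetValuesInertiaType.lean` (the Gauss factor of the tree's coset-value
identity depends on `χ` only through its inertia type `χ ∘ kappaArtinHom`; exact inertia level ⟹ the exact-level binder of
`DeShalit1987.exists_cosetValueIdentity`).

## References

* [deShalit1987] E. de Shalit, *Iwasawa theory of elliptic curves with complex multiplication* (1987), II.1.1, II.1.6–1.7
  (p. 37), II.2.5, II.4.8 (19) (p. 61), II.4.11 (30) (p. 65–66).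
* [NeukirchANT1999] J. Neukirch, *Algebraic Number Theory* (1999), Ch. VI (7.1) (the Artin map kills the ray `P^𝔪`).
-/

noncomputable section

open scoped Classical
open NumberField IsDedekindDomain Field
open Literature.NumberTheory.GaloisRepresentations
open Literature.NumberTheory.NumberFields
open Literature.NumberTheory.LFunctions
open Literature.NumberTheory.LFunctions.AbelianDensity (artinSymbol ArtinKillsRay artinSymbol_mul)

namespace Literature.NumberTheory.ComplexMultiplication.EllipticUnits

variable {K : Type} [Field K] [NumberField K]

/-! ## §1 The CFT membership lemma (D2): `((α), K(𝔤)/K) ∈ Gal(K(𝔤)/K(𝔣))` for `α ≡ 1 (𝔣)` -/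

/-- **The Artin symbol of `K(𝔣)/K` kills the ray `P_K^𝔣`** (`K` totally complex: no sign condition).
Dictionary: Neukirch VI (7.1) `ker = P^𝔪` ↦ tree `artinHom_galFrob_rayClassField_eq_one_iff`.
[cite: NeukirchANT1999, Ch. VI (7.1)] [cite: deShalit1987, II.1.1 (p. 31)] -/
theorem artinKillsRay_galFrob_rayClassField [IsTotallyComplex K] {𝔣 : Ideal (𝓞 K)} (h𝔣 : 𝔣 ≠ ⊥) :
    ArtinKillsRay 𝔣 (galFrob K (rayClassField K 𝔣)) := by
  rw [artinKillsRay_iff_ray_le_ker h𝔣]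
  intro I hI
  rw [MonoidHom.mem_ker]
  exact (artinHom_galFrob_rayClassField_eq_one_iff h𝔣 (ray_le_idealsPrimeTo h𝔣 hI)).mpr hI

/-- **`((α), K(𝔣)/K) = 1` for `α ≡ 1 (mod 𝔣)`, `α ≠ 0`** (principal ideals in the ray have trivial
Artin symbol in the ray class field). [de Shalit II.1.6–1.7 (p. 37): "if `𝔞 = (a)`, `a ≡ 1 mod 𝔤`, then …
`σ_𝔞` fixes `E[𝔤]` pointwise"; Neukirch VI (7.1)] [cite: deShalit1987, II.1.6–1.7 (p. 37)] [cite: NeukirchANT1999, Ch. VI (7.1)] -/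
theorem artinSymbol_span_singleton_eq_one [IsTotallyComplex K] {𝔣 : Ideal (𝓞 K)} (h𝔣 : 𝔣 ≠ ⊥)
    {α : 𝓞 K} (hα0 : α ≠ 0) (hα : α - 1 ∈ 𝔣) :
    artinSymbol (galFrob K (rayClassField K 𝔣)) (Ideal.span {α}) = 1 := by
  haveI := isEmpty_ringHom_real_of_isTotallyComplex K
  have hcop : IsCoprime (Ideal.span {(1 : 𝓞 K)}) 𝔣 := by
    rw [Ideal.span_singleton_one, ← Ideal.one_eq_top]; exact isCoprime_one_left
  have h := artinKillsRay_galFrob_rayClassField h𝔣 α 1 hα0 one_ne_zero hcop hα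
    (fun φ ↦ isEmptyElim φ)
  rw [Ideal.span_singleton_one, artinSymbol_top] at h
  exact h

omit [NumberField K] in
/-- `α ≡ 1 (mod 𝔣)` is prime to every `v ⊇ 𝔣`: no prime factor of `(α)` contains `𝔣`. [cite: NeukirchANT1999, Ch. VI (7.1)] -/
theorem not_le_of_dvd_span_singleton {𝔣 : Ideal (𝓞 K)} {α : 𝓞 K} (hα : α - 1 ∈ 𝔣)
    {v : HeightOneSpectrum (𝓞 K)} (hv : v.asIdeal ∣ Ideal.span {α}) : ¬ 𝔣 ≤ v.asIdeal := by
  intro hle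
  have hαv : α ∈ v.asIdeal := Ideal.le_of_dvd hv (Ideal.mem_span_singleton_self α)
  have h1 : (1 : 𝓞 K) ∈ v.asIdeal := by
    have := v.asIdeal.sub_mem hαv (hle hα)
    rwa [sub_sub_cancel] at this
  exact v.isPrime.ne_top ((Ideal.eq_top_iff_one _).mpr h1)

/-- **THE MEMBERSHIP LEMMA (D2).** For `0 ≠ 𝔤 ≤ 𝔣` (i.e. `𝔣 ∣ 𝔤`), `α ≠ 0`, `α ≡ 1 (mod 𝔣)`:
the Artin symbol `((α), K(𝔤)/K)` restricts trivially to `K(𝔣)`, i.e. lies in the tree's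
`relGalSet K 𝔤 𝔣 = Gal(K(𝔤)/K(𝔣))`. Print: II.4.8 (19) sums over `γ ∈ Gal(F_n/F)`, `F = K(𝔣)`,
`F_n = K(𝔣𝔭ⁿ)` (p. 61). Proof = tree CFT: Artin symbols restrict along `K(𝔣) ≤ K(𝔤)`
(`coe_artinSymbol_galFrob_inclusion_eq`, primes of `(α)` are unramified in `K(𝔣)`) + the previous lemma.
[cite: deShalit1987, II.4.8 (19) (p. 61), II.2.5 Proposition (i)] [cite: NeukirchANT1999, Ch. VI (7.1)] -/
theorem artinSymbol_span_singleton_mem_relGalSet [IsTotallyComplex K] {𝔣 𝔤 : Ideal (𝓞 K)}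
    (h𝔤 : 𝔤 ≠ ⊥) (hle : 𝔤 ≤ 𝔣) {α : 𝓞 K} (hα0 : α ≠ 0) (hα : α - 1 ∈ 𝔣) :
    artinSymbol (galFrob K (rayClassField K 𝔤)) (Ideal.span {α}) ∈ relGalSet K 𝔤 𝔣 := by
  have h𝔣 : 𝔣 ≠ ⊥ := ne_bot_of_le_ne_bot h𝔤 hle
  have hE : rayClassField K 𝔣 ≤ rayClassField K 𝔤 := rayClassField_le_of_le h𝔤 hle
  have h0 : Ideal.span {α} ≠ ⊥ := by simpa [Ideal.span_singleton_eq_bot] using hα0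
  have hunr : ∀ v : HeightOneSpectrum (𝓞 K), v.asIdeal ∣ Ideal.span {α} →
      Algebra.IsUnramifiedIn (𝓞 (rayClassField K 𝔣)) v.asIdeal :=
    fun v hv ↦ isUnramifiedIn_rayClassField h𝔣 (not_le_of_dvd_span_singleton hα hv)
  intro y hy hy'
  have key := coe_artinSymbol_galFrob_inclusion_eq hE h0 hunr ⟨y, hy'⟩
  have key' : ((artinSymbol (galFrob K (rayClassField K 𝔣)) (Ideal.span {α}) ⟨y, hy'⟩ :
      rayClassField K 𝔣) : AlgebraicClosure K) = y := by
    rw [artinSymbol_span_singleton_eq_one h𝔣 hα0 hα]; rfl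
  exact key.trans key'

/-! ### The `κ`-representatives `α_a ≡ 1 (𝔣)`, `α_a ≡ a (vⁿ)` of II.4.11 (30) -/

section KappaReps

variable {p : ℕ}

omit [NumberField K] in
/-- `α_a ∉ v` (`a` a unit mod `pⁿ`, `n ≥ 1`, `p ∈ v`); in particular `α_a ≠ 0`. [cite: deShalit1987, II.4.11 (30) (p. 65–66)] -/
theorem kappaRep_not_mem {v : HeightOneSpectrum (𝓞 K)} (hv : ((p : ℕ) : 𝓞 K) ∈ v.asIdeal)
    {n : ℕ} (hn : 1 ≤ n) (a : (ZMod (p ^ n))ˣ) {x : 𝓞 K}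
    (hx : x - ((a : ZMod (p ^ n)).val : 𝓞 K) ∈ v.asIdeal ^ n) : x ∉ v.asIdeal := by
  intro hxv
  obtain ⟨s, t, hst⟩ :
      IsCoprime ((((a : ZMod (p ^ n)).val : ℕ) : 𝓞 K)) (((p ^ n : ℕ) : 𝓞 K)) :=
    (ZMod.val_coe_unit_coprime a).cast
  have ha : (((a : ZMod (p ^ n)).val : ℕ) : 𝓞 K) ∈ v.asIdeal := by
    have := v.asIdeal.sub_mem hxv (Ideal.pow_le_self (by omega : n ≠ 0) hx)
    rwa [sub_sub_cancel] at this
  have hp : ((p ^ n : ℕ) : 𝓞 K) ∈ v.asIdeal := by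
    rw [Nat.cast_pow]; exact v.asIdeal.pow_mem_of_mem hv n (by omega)
  have h1 : (1 : 𝓞 K) ∈ v.asIdeal :=
    hst ▸ v.asIdeal.add_mem (v.asIdeal.mul_mem_left s ha) (v.asIdeal.mul_mem_left t hp)
  exact v.isPrime.ne_top ((Ideal.eq_top_iff_one _).mpr h1)

omit [NumberField K] in
/-- `α_a ≠ 0`. [cite: deShalit1987, II.4.11 (30) (p. 65–66)] -/
theorem kappaRep_ne_zero {v : HeightOneSpectrum (𝓞 K)} (hv : ((p : ℕ) : 𝓞 K) ∈ v.asIdeal)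
    {n : ℕ} (hn : 1 ≤ n) (a : (ZMod (p ^ n))ˣ) {x : 𝓞 K}
    (hx : x - ((a : ZMod (p ^ n)).val : 𝓞 K) ∈ v.asIdeal ^ n) : x ≠ 0 := by
  rintro rfl
  exact kappaRep_not_mem hv hn a hx (zero_mem _)

/-- **`δ_a = ((α_a), K(𝔣vⁿ)/K) ∈ Gal(K(𝔣vⁿ)/K(𝔣))`** for every `a ∈ (ℤ/pⁿ)ˣ` — the summation range
of the tree's `gaussSumInv` is print (19)'s `Gal(F_n/F)` (II.4.8, p. 61; II.4.11 (30), p. 65–66).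
[cite: deShalit1987, II.4.8 (19) (p. 61), II.4.11 (30) (p. 65–66)] -/
theorem artinSymbol_kappaRep_mem_relGalSet [IsTotallyComplex K] {v : HeightOneSpectrum (𝓞 K)}
    (hv : ((p : ℕ) : 𝓞 K) ∈ v.asIdeal) {𝔣 : Ideal (𝓞 K)} (h𝔣 : 𝔣 ≠ ⊥) {n : ℕ} (hn : 1 ≤ n)
    (a : (ZMod (p ^ n))ˣ) {x : 𝓞 K} (hx1 : x - 1 ∈ 𝔣)
    (hx : x - ((a : ZMod (p ^ n)).val : 𝓞 K) ∈ v.asIdeal ^ n) :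
    artinSymbol (galFrob K (rayClassField K (𝔣 * v.asIdeal ^ n))) (Ideal.span {x}) ∈
      relGalSet K (𝔣 * v.asIdeal ^ n) 𝔣 :=
  artinSymbol_span_singleton_mem_relGalSet (mul_ne_zero h𝔣 (pow_ne_zero n v.ne_bot))
    Ideal.mul_le_right (kappaRep_ne_zero hv hn a hx) hx1

omit [NumberField K] in
/-- `a ≡ 1 (mod p^{n-1})` gives `(a : 𝓞 K) − 1 ∈ v^{n-1}` (`p ∈ v`). [cite: deShalit1987, II.4.11 (30) (p. 65–66)] -/
theorem natCast_sub_one_mem_pow {v : HeightOneSpectrum (𝓞 K)} (hv : ((p : ℕ) : 𝓞 K) ∈ v.asIdeal)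
    {m a : ℕ} (ha : a ≡ 1 [MOD p ^ m]) : ((a : ℕ) : 𝓞 K) - 1 ∈ v.asIdeal ^ m := by
  have hdvd : ((p ^ m : ℕ) : ℤ) ∣ (1 : ℤ) - (a : ℤ) := by
    have := (Nat.modEq_iff_dvd.mp ha)
    simpa using this
  obtain ⟨c, hc⟩ := hdvd
  have hcast : ((a : ℕ) : 𝓞 K) - 1 = -(((p ^ m : ℕ) : 𝓞 K) * (c : 𝓞 K)) := by
    have h := congrArg (fun z : ℤ ↦ (z : 𝓞 K)) hc
    simp only [Int.cast_sub, Int.cast_one, Int.cast_natCast, Int.cast_mul] at h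
    linear_combination -h
  rw [hcast]
  refine neg_mem (Ideal.mul_mem_right _ _ ?_)
  rw [Nat.cast_pow]
  exact Ideal.pow_mem_pow hv m

/-- **Level `n−1` membership: for `a ≡ 1 (mod p^{n-1})`, `δ_a ∈ Gal(K(𝔣vⁿ)/K(𝔣v^{n-1}))`** — the
elements on which a character of EXACT `v`-level `n` must be nontrivial (the `hχ` binder of the tree's
`IsCosetValues` / `exists_cosetValueIdentity`). [cite: deShalit1987, II.1.7 (p. 37), II.4.11 (30) (p. 65–66)] -/
theorem artinSymbol_kappaRep_mem_relGalSet_pred [IsTotallyComplex K] {v : HeightOneSpectrum (𝓞 K)}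
    (hv : ((p : ℕ) : 𝓞 K) ∈ v.asIdeal) {𝔣 : Ideal (𝓞 K)} (h𝔣 : 𝔣 ≠ ⊥)
    (h𝔣v : IsCoprime 𝔣 v.asIdeal) {n : ℕ} (hn : 1 ≤ n)
    (a : (ZMod (p ^ n))ˣ) {x : 𝓞 K} (hx1 : x - 1 ∈ 𝔣)
    (hx : x - ((a : ZMod (p ^ n)).val : 𝓞 K) ∈ v.asIdeal ^ n)
    (ha : (a : ZMod (p ^ n)).val ≡ 1 [MOD p ^ (n - 1)]) :
    artinSymbol (galFrob K (rayClassField K (𝔣 * v.asIdeal ^ n))) (Ideal.span {x}) ∈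
      relGalSet K (𝔣 * v.asIdeal ^ n) (𝔣 * v.asIdeal ^ (n - 1)) := by
  refine artinSymbol_span_singleton_mem_relGalSet (mul_ne_zero h𝔣 (pow_ne_zero n v.ne_bot))
    (Ideal.mul_mono_right (Ideal.pow_le_pow_right (Nat.sub_le n 1))) (kappaRep_ne_zero hv hn a hx) ?_
  have hv' : x - 1 ∈ v.asIdeal ^ (n - 1) := by
    have h1 : x - ((a : ZMod (p ^ n)).val : 𝓞 K) ∈ v.asIdeal ^ (n - 1) :=
      Ideal.pow_le_pow_right (Nat.sub_le n 1) hx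
    have h2 := natCast_sub_one_mem_pow (K := K) hv ha
    have := (v.asIdeal ^ (n - 1)).add_mem h1 h2
    rwa [sub_add_sub_cancel] at this
  have hcop : IsCoprime 𝔣 (v.asIdeal ^ (n - 1)) := IsCoprime.pow_right h𝔣v
  rw [Ideal.mul_eq_inf_of_isCoprime hcop]
  exact Submodule.mem_inf.mpr ⟨hx1, hv'⟩

/-! ## §2 II.1.7: `δ : (ℤ/pⁿ)ˣ → Gal(K(𝔣vⁿ)/K)` is a homomorphism, independent of the representatives -/

omit [NumberField K] in
/-- `(a·b : ℤ/pⁿ).val ≡ a.val · b.val` read in `vⁿ`: `(a.val b.val : 𝓞 K) − ((ab).val : 𝓞 K) ∈ vⁿ`. [cite: deShalit1987, II.1.7 (p. 37)] -/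
theorem natCast_val_mul_sub_mem_pow {v : HeightOneSpectrum (𝓞 K)} (hv : ((p : ℕ) : 𝓞 K) ∈ v.asIdeal)
    {n : ℕ} (a b : ZMod (p ^ n)) :
    ((a.val : ℕ) : 𝓞 K) * ((b.val : ℕ) : 𝓞 K) - (((a * b).val : ℕ) : 𝓞 K) ∈ v.asIdeal ^ n := by
  have h : a.val * b.val = (a * b).val + p ^ n * (a.val * b.val / p ^ n) := by
    rw [ZMod.val_mul]; exact (Nat.mod_add_div _ _).symm
  have hcast : ((a.val : ℕ) : 𝓞 K) * ((b.val : ℕ) : 𝓞 K) - (((a * b).val : ℕ) : 𝓞 K) =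
      ((p ^ n : ℕ) : 𝓞 K) * ((a.val * b.val / p ^ n : ℕ) : 𝓞 K) := by
    have := congrArg (fun m : ℕ ↦ (m : 𝓞 K)) h
    simp only [Nat.cast_mul, Nat.cast_add] at this
    linear_combination this
  rw [hcast, Nat.cast_pow]
  exact Ideal.mul_mem_right _ _ (Ideal.pow_mem_pow hv n)

/-- The `κ`-representatives are prime to `𝔣vⁿ` (`α_a ≡ 1 (𝔣)`, `α_a ≡ a (vⁿ)`, `a` a unit mod `pⁿ`); a copy of
the tree's `DeShalit1987.isCoprime_span_kappaRep` kept private here to avoid an upward import.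
[cite: deShalit1987, II.4.11 (30) (p. 65–66)] -/
private theorem isCoprime_span_kappaRep' {v : HeightOneSpectrum (𝓞 K)} (hv : ((p : ℕ) : 𝓞 K) ∈ v.asIdeal)
    {n : ℕ} (hn : 1 ≤ n) {𝔣 : Ideal (𝓞 K)} (a : (ZMod (p ^ n))ˣ) {x : 𝓞 K} (hx1 : x - 1 ∈ 𝔣)
    (hx : x - ((a : ZMod (p ^ n)).val : 𝓞 K) ∈ v.asIdeal ^ n) :
    IsCoprime (Ideal.span {x}) (𝔣 * v.asIdeal ^ n) := by
  refine IsCoprime.mul_right ?_ (IsCoprime.pow_right ?_)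
  · exact Ideal.isCoprime_iff_exists.mpr
      ⟨x, Ideal.mem_span_singleton_self x, 1 - x, by simpa using 𝔣.neg_mem hx1, by ring⟩
  · rw [Ideal.isCoprime_iff_sup_eq]
    have hmax : v.asIdeal.IsMaximal := v.isPrime.isMaximal v.ne_bot
    refine hmax.1.2 _ (lt_of_le_of_ne le_sup_right fun h ↦ kappaRep_not_mem hv hn a hx ?_)
    rw [h]; exact le_sup_left (b := v.asIdeal) (Ideal.mem_span_singleton_self x)

/-- **Independence of representatives / multiplicativity input**: two `κ`-representatives data
`x ≡ 1 (𝔣), x ≡ a (vⁿ)` and `y ≡ 1 (𝔣), y ≡ a (vⁿ)` of the SAME class have the same Artin symbol in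
`K(𝔣vⁿ)` (the Artin symbol kills the ray mod `𝔣vⁿ`). [cite: deShalit1987, II.1.7 (p. 37)] [cite: NeukirchANT1999, Ch. VI (7.1)] -/
theorem artinSymbol_kappaRep_congr [IsTotallyComplex K] {v : HeightOneSpectrum (𝓞 K)}
    (hv : ((p : ℕ) : 𝓞 K) ∈ v.asIdeal) {𝔣 : Ideal (𝓞 K)} (h𝔣 : 𝔣 ≠ ⊥)
    (h𝔣v : IsCoprime 𝔣 v.asIdeal) {n : ℕ} (hn : 1 ≤ n) (a : (ZMod (p ^ n))ˣ) {x y : 𝓞 K}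
    (hx1 : x - 1 ∈ 𝔣) (hx : x - ((a : ZMod (p ^ n)).val : 𝓞 K) ∈ v.asIdeal ^ n)
    (hy1 : y - 1 ∈ 𝔣) (hy : y - ((a : ZMod (p ^ n)).val : 𝓞 K) ∈ v.asIdeal ^ n) :
    artinSymbol (galFrob K (rayClassField K (𝔣 * v.asIdeal ^ n))) (Ideal.span {x}) =
      artinSymbol (galFrob K (rayClassField K (𝔣 * v.asIdeal ^ n))) (Ideal.span {y}) := by
  haveI := isEmpty_ringHom_real_of_isTotallyComplex K
  have h𝔤 : 𝔣 * v.asIdeal ^ n ≠ ⊥ := mul_ne_zero h𝔣 (pow_ne_zero n v.ne_bot)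
  refine artinKillsRay_galFrob_rayClassField h𝔤 x y (kappaRep_ne_zero hv hn a hx)
    (kappaRep_ne_zero hv hn a hy) (isCoprime_span_kappaRep' hv hn a hy1 hy) ?_ (fun φ ↦ isEmptyElim φ)
  have hf : x - y ∈ 𝔣 := by
    have := 𝔣.sub_mem hx1 hy1; rwa [sub_sub_sub_cancel_right] at this
  have hvn : x - y ∈ v.asIdeal ^ n := by
    have := (v.asIdeal ^ n).sub_mem hx hy; rwa [sub_sub_sub_cancel_right] at this
  rw [Ideal.mul_eq_inf_of_isCoprime (IsCoprime.pow_right h𝔣v)]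
  exact Submodule.mem_inf.mpr ⟨hf, hvn⟩

/-- **Multiplicativity**: `δ_{ab} = δ_a · δ_b` for any `κ`-representatives (II.1.7: `a ↦ δ_a` is the
isomorphism `(𝒪_K/𝔭ⁿ)ˣ ≅ Gal(K(𝔣𝔭ⁿ)/K(𝔣))` for `w_𝔣 = 1`; here only the homomorphism property).
[cite: deShalit1987, II.1.7 (p. 37)] -/
theorem artinSymbol_kappaRep_mul [IsTotallyComplex K] {v : HeightOneSpectrum (𝓞 K)}
    (hv : ((p : ℕ) : 𝓞 K) ∈ v.asIdeal) {𝔣 : Ideal (𝓞 K)} (h𝔣 : 𝔣 ≠ ⊥)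
    (h𝔣v : IsCoprime 𝔣 v.asIdeal) {n : ℕ} (hn : 1 ≤ n) {α : (ZMod (p ^ n))ˣ → 𝓞 K}
    (hα : ∀ a, α a - 1 ∈ 𝔣 ∧ α a - ((a : ZMod (p ^ n)).val : 𝓞 K) ∈ v.asIdeal ^ n)
    (a b : (ZMod (p ^ n))ˣ) :
    artinSymbol (galFrob K (rayClassField K (𝔣 * v.asIdeal ^ n))) (Ideal.span {α (a * b)}) =
      artinSymbol (galFrob K (rayClassField K (𝔣 * v.asIdeal ^ n))) (Ideal.span {α a}) *
        artinSymbol (galFrob K (rayClassField K (𝔣 * v.asIdeal ^ n))) (Ideal.span {α b}) := by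
  have ha0 : Ideal.span {α a} ≠ ⊥ := by
    simpa [Ideal.span_singleton_eq_bot] using kappaRep_ne_zero hv hn a (hα a).2
  have hb0 : Ideal.span {α b} ≠ ⊥ := by
    simpa [Ideal.span_singleton_eq_bot] using kappaRep_ne_zero hv hn b (hα b).2
  rw [← artinSymbol_mul _ ha0 hb0, Ideal.span_singleton_mul_span_singleton]
  -- `α_a α_b` is another representative of the class `ab`
  refine artinSymbol_kappaRep_congr hv h𝔣 h𝔣v hn (a * b) (hα (a * b)).1 (hα (a * b)).2 ?_ ?_
  · have : α a * α b - 1 = (α a - 1) * α b + (α b - 1) := by ring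
    rw [this]
    exact 𝔣.add_mem (𝔣.mul_mem_right _ (hα a).1) (hα b).1
  · have : α a * α b - ((((a * b : (ZMod (p ^ n))ˣ) : ZMod (p ^ n)).val : ℕ) : 𝓞 K) =
        (α a - ((a : ZMod (p ^ n)).val : 𝓞 K)) * α b +
          ((a : ZMod (p ^ n)).val : 𝓞 K) * (α b - ((b : ZMod (p ^ n)).val : 𝓞 K)) +
          ((((a : ZMod (p ^ n)).val : ℕ) : 𝓞 K) * (((b : ZMod (p ^ n)).val : ℕ) : 𝓞 K) -
            ((((a : ZMod (p ^ n)) * (b : ZMod (p ^ n))).val : ℕ) : 𝓞 K)) := by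
      rw [Units.val_mul]; ring
    rw [this]
    exact (v.asIdeal ^ n).add_mem ((v.asIdeal ^ n).add_mem ((v.asIdeal ^ n).mul_mem_right _ (hα a).2)
      ((v.asIdeal ^ n).mul_mem_left _ (hα b).2)) (natCast_val_mul_sub_mem_pow hv _ _)

/-- **The inertia-type homomorphism `δ : (ℤ/pⁿ)ˣ →* Gal(K(𝔣vⁿ)/K)`, `a ↦ ((α_a), K(𝔣vⁿ)/K)`**
(II.1.7 / II.4.11 (30): the parametrisation of `Gal(F_n/F)` by `κ`; values in `relGalSet K (𝔣vⁿ) 𝔣` by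
`artinSymbol_kappaRep_mem_relGalSet`). [cite: deShalit1987, II.1.7 (p. 37), II.4.11 (30) (p. 65)] -/
def kappaArtinHom [IsTotallyComplex K] {v : HeightOneSpectrum (𝓞 K)}
    (hv : ((p : ℕ) : 𝓞 K) ∈ v.asIdeal) {𝔣 : Ideal (𝓞 K)} (h𝔣 : 𝔣 ≠ ⊥)
    (h𝔣v : IsCoprime 𝔣 v.asIdeal) {n : ℕ} (hn : 1 ≤ n) {α : (ZMod (p ^ n))ˣ → 𝓞 K}
    (hα : ∀ a, α a - 1 ∈ 𝔣 ∧ α a - ((a : ZMod (p ^ n)).val : 𝓞 K) ∈ v.asIdeal ^ n) :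
    (ZMod (p ^ n))ˣ →* (rayClassField K (𝔣 * v.asIdeal ^ n) ≃ₐ[K] rayClassField K (𝔣 * v.asIdeal ^ n)) :=
  MonoidHom.mk' (fun a ↦ artinSymbol (galFrob K (rayClassField K (𝔣 * v.asIdeal ^ n))) (Ideal.span {α a}))
    (artinSymbol_kappaRep_mul hv h𝔣 h𝔣v hn hα)

/-- Unfolding lemma for `kappaArtinHom`. [cite: deShalit1987, II.1.7 (p. 37)] -/
@[simp] theorem kappaArtinHom_apply [IsTotallyComplex K] {v : HeightOneSpectrum (𝓞 K)}
    (hv : ((p : ℕ) : 𝓞 K) ∈ v.asIdeal) {𝔣 : Ideal (𝓞 K)} (h𝔣 : 𝔣 ≠ ⊥)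
    (h𝔣v : IsCoprime 𝔣 v.asIdeal) {n : ℕ} (hn : 1 ≤ n) {α : (ZMod (p ^ n))ˣ → 𝓞 K}
    (hα : ∀ a, α a - 1 ∈ 𝔣 ∧ α a - ((a : ZMod (p ^ n)).val : 𝓞 K) ∈ v.asIdeal ^ n)
    (a : (ZMod (p ^ n))ˣ) :
    kappaArtinHom hv h𝔣 h𝔣v hn hα a =
      artinSymbol (galFrob K (rayClassField K (𝔣 * v.asIdeal ^ n))) (Ideal.span {α a}) := rfl

/-- The homomorphism does not depend on the choice of `κ`-representatives. [cite: deShalit1987, II.1.7 (p. 37)] -/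
theorem kappaArtinHom_congr [IsTotallyComplex K] {v : HeightOneSpectrum (𝓞 K)}
    (hv : ((p : ℕ) : 𝓞 K) ∈ v.asIdeal) {𝔣 : Ideal (𝓞 K)} (h𝔣 : 𝔣 ≠ ⊥)
    (h𝔣v : IsCoprime 𝔣 v.asIdeal) {n : ℕ} (hn : 1 ≤ n) {α β : (ZMod (p ^ n))ˣ → 𝓞 K}
    (hα : ∀ a, α a - 1 ∈ 𝔣 ∧ α a - ((a : ZMod (p ^ n)).val : 𝓞 K) ∈ v.asIdeal ^ n)
    (hβ : ∀ a, β a - 1 ∈ 𝔣 ∧ β a - ((a : ZMod (p ^ n)).val : 𝓞 K) ∈ v.asIdeal ^ n) :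
    kappaArtinHom hv h𝔣 h𝔣v hn hα = kappaArtinHom hv h𝔣 h𝔣v hn hβ :=
  MonoidHom.ext fun a ↦ artinSymbol_kappaRep_congr hv h𝔣 h𝔣v hn a (hα a).1 (hα a).2 (hβ a).1 (hβ a).2

end KappaReps

end Literature.NumberTheory.ComplexMultiplication.EllipticUnits

end
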